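import Literature.Analysis.ValidatedNumerics.RExprMeanValueForm
import HarnessLib

/-!
# A second-order centred form with a certified remainder for `RExpr` terms

Topic `Literature/Analysis/ValidatedNumerics`. `RExprMeanValueForm.lean` makes the MEAN VALUE FORM of a
rational-operation `RExpr` term kernel-checkable: `|e(x) − e(c) − Σ_k a_k δ_k| ≤ Σ_k w_k · dev([∂_k e](B), a_k)`
(`δ = x − c`), a remainder of order `w²`. Iterating the same one-dimensional arguments once more gives a
SECOND-ORDER form with an `O(w³)` remainder (Neumaier 1990 §2.4 Interpolation forms, remarks (iv)/(vii) — the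
one-dimensional second-order Taylor form with cubic approximation order; the multivariate staircase assembly is
this file's own; Moore 1979 §4.4 for the mean value form the proof iterates): for ANY rational coefficients
`a_m` (slopes), `a_{ml}` (mixed, `l, m < K`) and `q_m` (half the pure second derivatives),
`|e(x) − e(c) − Σ_m a_m δ_m − Σ_m Σ_{l<m} a_{ml} δ_l δ_m − Σ_m q_m δ_m²|`
`  ≤ Σ_m w_m · (dev([∂_m e](c), a_m) + Σ_{l<K} w_l · dev([∂_l ∂_m e](B), a_{ml})) + Σ_m w_m² · dev([∂_m ∂_m e](B), 2 q_m)`,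
where every `[·]` is the kernel's own interval extension of the kernel's own symbolic derivatives. Proof:
the coordinate STAIRCASE of the first-order file; on the `m`-th segment the function `g(t) = f(t) − f(c_m)
− f′(c_m)(t − c_m) − q_m (t − c_m)²` has `|g′(t)| ≤ |t − c_m| · dev([∂_m∂_m e](B), 2 q_m)` (Lagrange on `f′`)
hence `|g(x_m)| ≤ δ_m² · dev` (Lagrange on `g`), and `f′(c_m) = ∂_m e` at the staircase point is expanded by
the FIRST-ORDER theorem applied to the term `pderiv m e`. No integrals, no multivariate calculus.

* `RExpr.smooth_pderiv`, `RExpr.varsLT_pderiv` (the symbolic derivative stays in the smooth sub-language);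
* `RExpr.abs_eval_update_sub_quad_le` — the one-coordinate second-order step;
* **`RExpr.abs_eval_sub_secondForm_le`** — the box theorem above;
* `RExpr.rem2Q`, **`RExpr.aff2EntryOK`** (computable) + **`RExpr.aff2EntryOK_sound`**: with `a₀` a centre value,
  `|e(x) − (a₀ + Σ_m a_m δ_m + Σ_{l<m} a_{ml} δ_l δ_m + Σ_m q_m δ_m²)| ≤ R` on the box.

Consumer: second-order entry models of `RExpr` matrix families for the parametric Lyapunov certificates
(first-order models leave an `O(w²)` entry radius that dominates the leaf radius from Taylor order 3 on).
NOT here: third order; non-smooth terms. Everything here is proved; no named facts.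
-/

noncomputable section

open Finset NonemptyInterval Set

namespace Literature.Analysis.ValidatedNumerics

namespace RExpr

/-! ### The derivative of a smooth term is a smooth term in the same variables -/

/-- `pderiv` preserves `smooth` (the symbolic derivative of a rational-operation term is a rational-operation term).
[cite: Moore1979, §3.4 and §4.4 (D_iT rules, p. 44)] -/
theorem smooth_pderiv (k : ℕ) : ∀ e : RExpr, smooth e = true → smooth (pderiv k e) = true
  | const _, _ => rfl
  | var i, _ => by unfold pderiv; split <;> rfl
  | add e₁ e₂, h => by
    simp only [smooth, Bool.and_eq_true] at h
    simp only [pderiv, smooth, Bool.and_eq_true]; exact ⟨smooth_pderiv k e₁ h.1, smooth_pderiv k e₂ h.2⟩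
  | sub e₁ e₂, h => by
    simp only [smooth, Bool.and_eq_true] at h
    simp only [pderiv, smooth, Bool.and_eq_true]; exact ⟨smooth_pderiv k e₁ h.1, smooth_pderiv k e₂ h.2⟩
  | mul e₁ e₂, h => by
    simp only [smooth, Bool.and_eq_true] at h
    simp only [pderiv, smooth, Bool.and_eq_true]
    exact ⟨⟨smooth_pderiv k e₁ h.1, h.2⟩, h.1, smooth_pderiv k e₂ h.2⟩
  | neg e, h => by simp only [smooth] at h; simp only [pderiv, smooth]; exact smooth_pderiv k e h
  | sq e, h => by
    simp only [smooth] at h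
    simp only [pderiv, smooth, Bool.and_eq_true, Bool.true_and]; exact ⟨h, smooth_pderiv k e h⟩
  | inv e, h => by
    simp only [smooth] at h
    simp only [pderiv, smooth, Bool.and_eq_true]; exact ⟨smooth_pderiv k e h, h⟩
  | abs _, h | sqrt _, h | min _ _, h | max _ _, h => by simp [smooth] at h

/-- `pderiv` preserves `varsLT K` (no new variables appear in the symbolic derivative).
[cite: Moore1979, §3.4 and §4.4 (D_iT rules, p. 44)] -/
theorem varsLT_pderiv (K k : ℕ) : ∀ e : RExpr, varsLT K e = true → varsLT K (pderiv k e) = true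
  | const _, _ => rfl
  | var i, _ => by unfold pderiv; split <;> rfl
  | add e₁ e₂, h => by
    simp only [varsLT, Bool.and_eq_true] at h
    simp only [pderiv, varsLT, Bool.and_eq_true]; exact ⟨varsLT_pderiv K k e₁ h.1, varsLT_pderiv K k e₂ h.2⟩
  | sub e₁ e₂, h => by
    simp only [varsLT, Bool.and_eq_true] at h
    simp only [pderiv, varsLT, Bool.and_eq_true]; exact ⟨varsLT_pderiv K k e₁ h.1, varsLT_pderiv K k e₂ h.2⟩
  | mul e₁ e₂, h => by
    simp only [varsLT, Bool.and_eq_true] at h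
    simp only [pderiv, varsLT, Bool.and_eq_true]
    exact ⟨⟨varsLT_pderiv K k e₁ h.1, h.2⟩, h.1, varsLT_pderiv K k e₂ h.2⟩
  | neg e, h => by simp only [varsLT] at h; simp only [pderiv, varsLT]; exact varsLT_pderiv K k e h
  | sq e, h => by
    simp only [varsLT] at h
    simp only [pderiv, varsLT, Bool.and_eq_true, Bool.true_and]; exact ⟨h, varsLT_pderiv K k e h⟩
  | inv e, h => by
    simp only [varsLT] at h
    simp only [pderiv, varsLT, Bool.and_eq_true]; exact ⟨varsLT_pderiv K k e h, h⟩
  | abs _, _ | sqrt _, _ | min _ _, _ | max _ _, _ => by simp only [pderiv, varsLT]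

/-! ### Box plumbing (the private lemmas of the first-order file, restated) -/

/-- Replacing one coordinate of a box point by a value in that coordinate's interval stays in the box.
[folklore] -/
private theorem mem_update₂ {B : Box} {z : ℕ → ℝ} (hz : B.mem z) (k : ℕ) {t : ℝ}
    (ht : ((B.ivl k).1 : ℝ) ≤ t ∧ t ≤ ((B.ivl k).2 : ℝ)) : B.mem (Function.update z k t) := by
  intro i
  by_cases hik : i = k
  · subst hik; rw [Function.update_self]; exact ht
  · rw [Function.update_of_ne hik]; exact hz i

/-- The centre lies in the box. [folklore] -/
private theorem mem_cen₂ {B : Box} {x : ℕ → ℝ} (hx : B.mem x) : B.mem fun i ↦ ((B.cen i : ℚ) : ℝ) := by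
  intro i; have h := hx i; unfold Box.cen; push_cast; constructor <;> linarith [h.1, h.2]

/-- Points are within the half-width of the centre. [folklore] -/
private theorem abs_sub_cen_le₂ {B : Box} {x : ℕ → ℝ} (hx : B.mem x) (i : ℕ) :
    |x i - ((B.cen i : ℚ) : ℝ)| ≤ ((B.hw i : ℚ) : ℝ) := by
  have h := hx i; unfold Box.cen Box.hw; push_cast; rw [abs_le]; constructor <;> linarith [h.1, h.2]

/-- Half-widths are nonnegative once the box has a point. [folklore] -/
private theorem hw_nonneg₂ {B : Box} {x : ℕ → ℝ} (hx : B.mem x) (i : ℕ) : (0 : ℝ) ≤ ((B.hw i : ℚ) : ℝ) :=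
  (abs_nonneg _).trans (abs_sub_cen_le₂ hx i)

/-- A term with variables `< K` takes equal values at points agreeing below `K`. [folklore] -/
private theorem eval_congr₂ {K : ℕ} {x y : ℕ → ℝ} (hxy : ∀ i < K, x i = y i) (e : RExpr)
    (h : varsLT K e = true) : e.eval x = e.eval y := by
  induction e with
  | const q => rfl
  | var i => simp only [varsLT, decide_eq_true_eq] at h; exact hxy i h
  | add e₁ e₂ ih₁ ih₂ | sub e₁ e₂ ih₁ ih₂ | mul e₁ e₂ ih₁ ih₂ | min e₁ e₂ ih₁ ih₂ | max e₁ e₂ ih₁ ih₂ =>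
    simp only [varsLT, Bool.and_eq_true] at h; simp only [eval, ih₁ h.1, ih₂ h.2]
  | neg e ih | sq e ih | inv e ih | abs e ih | sqrt e ih => simp only [eval, ih h]

/-! ### One coordinate, second order -/

/-- **One coordinate step of the second-order form**: for `z` in the box, `t₁, t₂` in coordinate `m`'s
interval and any rational `q`,
`|e(z;t₂) − e(z;t₁) − ∂_m e(z;t₁)·(t₂ − t₁) − q (t₂ − t₁)²| ≤ (t₂ − t₁)² · dev([∂_m∂_m e](B), 2q)`.
Lagrange twice: on `∂_m e` along the segment (its derivative `∂_m∂_m e` lies in the enclosure) to bound the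
derivative of `g(t) = e(z;t) − e(z;t₁) − ∂_m e(z;t₁)(t − t₁) − q(t − t₁)²`, then on `g`.
[cite: Moore1979, §4.4 eq. (4.19) (p. 43); Neumaier1991, Thm. 2.3.3; Neumaier1991, §2.4 remark (vii) (second-order
Taylor form, cubic approximation order)] -/
theorem abs_eval_update_sub_quad_le {prec iters : ℕ} {B : Box} {z : ℕ → ℝ} (hz : B.mem z) (m : ℕ)
    (e : RExpr) (hs : smooth e = true) (he : ∃ I, e.enclose prec iters B.toIvl = some I)
    (he' : ∃ I, (pderiv m e).enclose prec iters B.toIvl = some I)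
    {G : NonemptyInterval ℚ} (hG : (pderiv m (pderiv m e)).enclose prec iters B.toIvl = some G) (q : ℚ)
    {t₁ t₂ : ℝ} (ht₁ : ((B.ivl m).1 : ℝ) ≤ t₁ ∧ t₁ ≤ ((B.ivl m).2 : ℝ))
    (ht₂ : ((B.ivl m).1 : ℝ) ≤ t₂ ∧ t₂ ≤ ((B.ivl m).2 : ℝ)) :
    |e.eval (Function.update z m t₂) - e.eval (Function.update z m t₁)
        - (pderiv m e).eval (Function.update z m t₁) * (t₂ - t₁) - (q : ℝ) * (t₂ - t₁) ^ 2|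
      ≤ (t₂ - t₁) ^ 2 * (devQ G (2 * q) : ℝ) := by
  set f : ℝ → ℝ := fun t ↦ e.eval (Function.update z m t) with hf
  set f' : ℝ → ℝ := fun t ↦ (pderiv m e).eval (Function.update z m t) with hf'
  set f'' : ℝ → ℝ := fun t ↦ (pderiv m (pderiv m e)).eval (Function.update z m t) with hf''
  have seg : ∀ t : ℝ, ((B.ivl m).1 : ℝ) ≤ t ∧ t ≤ ((B.ivl m).2 : ℝ) → B.mem (Function.update z m t) :=
    fun t ht ↦ mem_update₂ hz m ht
  have hder : ∀ t : ℝ, ((B.ivl m).1 : ℝ) ≤ t ∧ t ≤ ((B.ivl m).2 : ℝ) → HasDerivAt f (f' t) t := by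
    intro t ht
    have h := hasDerivAt_eval_update (prec := prec) (iters := iters) (X := B.toIvl)
      (x := Function.update z m t) (fun i ↦ Box.mem_toIvl (seg t ht) i) m e hs he
    simp only [Function.update_idem, Function.update_self] at h
    exact h
  have hder' : ∀ t : ℝ, ((B.ivl m).1 : ℝ) ≤ t ∧ t ≤ ((B.ivl m).2 : ℝ) → HasDerivAt f' (f'' t) t := by
    intro t ht
    have h := hasDerivAt_eval_update (prec := prec) (iters := iters) (X := B.toIvl)
      (x := Function.update z m t) (fun i ↦ Box.mem_toIvl (seg t ht) i) m (pderiv m e)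
      (smooth_pderiv m e hs) he'
    simp only [Function.update_idem, Function.update_self] at h
    exact h
  -- the second derivative lies in G, hence |f''(t) − 2q| ≤ dev
  have hG' : ∀ t : ℝ, ((B.ivl m).1 : ℝ) ≤ t ∧ t ≤ ((B.ivl m).2 : ℝ) → |f'' t - ((2 * q : ℚ) : ℝ)| ≤ (devQ G (2 * q) : ℝ) :=
    fun t ht ↦ abs_sub_le_devQ (eval_mem_enclose (fun i ↦ Box.mem_toIvl (seg t ht) i) _ hG)
  -- Lagrange on f' between t₁ and t: |f'(t) − f'(t₁) − 2q (t − t₁)| ≤ |t − t₁| dev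
  have hslope : ∀ t : ℝ, ((B.ivl m).1 : ℝ) ≤ t ∧ t ≤ ((B.ivl m).2 : ℝ) →
      |f' t - f' t₁ - ((2 * q : ℚ) : ℝ) * (t - t₁)| ≤ |t - t₁| * (devQ G (2 * q) : ℝ) := by
    intro t ht
    have key : ∃ ξ : ℝ, (((B.ivl m).1 : ℝ) ≤ ξ ∧ ξ ≤ ((B.ivl m).2 : ℝ)) ∧ f' t - f' t₁ = f'' ξ * (t - t₁) := by
      rcases lt_trichotomy t₁ t with hlt | heq | hgt
      · have hc : ContinuousOn f' (Icc t₁ t) := fun s hs' ↦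
          (hder' s ⟨ht₁.1.trans hs'.1, hs'.2.trans ht.2⟩).continuousAt.continuousWithinAt
        obtain ⟨ξ, hξ, hξ'⟩ := exists_hasDerivAt_eq_slope f' f'' hlt hc
          (fun s hs' ↦ hder' s ⟨ht₁.1.trans hs'.1.le, hs'.2.le.trans ht.2⟩)
        refine ⟨ξ, ⟨ht₁.1.trans hξ.1.le, hξ.2.le.trans ht.2⟩, ?_⟩
        rw [hξ', div_mul_cancel₀ _ (sub_ne_zero.2 hlt.ne')]
      · subst heq; exact ⟨t₁, ht₁, by simp⟩
      · have hc : ContinuousOn f' (Icc t t₁) := fun s hs' ↦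
          (hder' s ⟨ht.1.trans hs'.1, hs'.2.trans ht₁.2⟩).continuousAt.continuousWithinAt
        obtain ⟨ξ, hξ, hξ'⟩ := exists_hasDerivAt_eq_slope f' f'' hgt hc
          (fun s hs' ↦ hder' s ⟨ht.1.trans hs'.1.le, hs'.2.le.trans ht₁.2⟩)
        refine ⟨ξ, ⟨ht.1.trans hξ.1.le, hξ.2.le.trans ht₁.2⟩, ?_⟩
        have e1 : f' t₁ - f' t = f'' ξ * (t₁ - t) := by
          rw [hξ', div_mul_cancel₀ _ (sub_ne_zero.2 hgt.ne')]
        linarith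
    obtain ⟨ξ, hξ, hfe⟩ := key
    have e2 : f' t - f' t₁ - ((2 * q : ℚ) : ℝ) * (t - t₁) = (f'' ξ - ((2 * q : ℚ) : ℝ)) * (t - t₁) := by
      rw [hfe]; ring
    rw [e2, abs_mul, mul_comm]
    exact mul_le_mul_of_nonneg_left (hG' ξ hξ) (abs_nonneg _)
  -- the auxiliary function g and its derivative
  set g : ℝ → ℝ := fun t ↦ f t - f t₁ - f' t₁ * (t - t₁) - (q : ℝ) * (t - t₁) ^ 2 with hg
  set g' : ℝ → ℝ := fun t ↦ f' t - f' t₁ - ((2 * q : ℚ) : ℝ) * (t - t₁) with hg'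
  have hgder : ∀ t : ℝ, ((B.ivl m).1 : ℝ) ≤ t ∧ t ≤ ((B.ivl m).2 : ℝ) → HasDerivAt g (g' t) t := by
    intro t ht
    have h1 := hder t ht
    have h2 : HasDerivAt (fun s : ℝ ↦ f' t₁ * (s - t₁)) (f' t₁ * 1) t :=
      ((hasDerivAt_id t).sub_const t₁).const_mul _
    have h3 : HasDerivAt (fun s : ℝ ↦ (q : ℝ) * (s - t₁) ^ 2) ((q : ℝ) * (2 * (t - t₁) ^ (2 - 1) * 1)) t :=
      (((hasDerivAt_id t).sub_const t₁).pow 2).const_mul _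
    have h := ((h1.sub_const (f t₁)).sub h2).sub h3
    refine h.congr_deriv ?_
    simp only [hg']
    push_cast
    ring
  -- Lagrange on g between t₁ and t₂; g t₁ = 0
  have hg0 : g t₁ = 0 := by simp [hg]
  have main : |g t₂| ≤ (t₂ - t₁) ^ 2 * (devQ G (2 * q) : ℝ) := by
    have key : ∃ ζ : ℝ, (((B.ivl m).1 : ℝ) ≤ ζ ∧ ζ ≤ ((B.ivl m).2 : ℝ)) ∧ |ζ - t₁| ≤ |t₂ - t₁| ∧
        g t₂ - g t₁ = g' ζ * (t₂ - t₁) := by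
      rcases lt_trichotomy t₁ t₂ with hlt | heq | hgt
      · have hc : ContinuousOn g (Icc t₁ t₂) := fun s hs' ↦
          (hgder s ⟨ht₁.1.trans hs'.1, hs'.2.trans ht₂.2⟩).continuousAt.continuousWithinAt
        obtain ⟨ζ, hζ, hζ'⟩ := exists_hasDerivAt_eq_slope g g' hlt hc
          (fun s hs' ↦ hgder s ⟨ht₁.1.trans hs'.1.le, hs'.2.le.trans ht₂.2⟩)
        refine ⟨ζ, ⟨ht₁.1.trans hζ.1.le, hζ.2.le.trans ht₂.2⟩, ?_, ?_⟩
        · rw [abs_of_pos (sub_pos.2 hζ.1), abs_of_pos (sub_pos.2 hlt)]; exact sub_le_sub_right hζ.2.le _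
        · rw [hζ', div_mul_cancel₀ _ (sub_ne_zero.2 hlt.ne')]
      · subst heq; exact ⟨t₁, ht₁, by simp, by simp⟩
      · have hc : ContinuousOn g (Icc t₂ t₁) := fun s hs' ↦
          (hgder s ⟨ht₂.1.trans hs'.1, hs'.2.trans ht₁.2⟩).continuousAt.continuousWithinAt
        obtain ⟨ζ, hζ, hζ'⟩ := exists_hasDerivAt_eq_slope g g' hgt hc
          (fun s hs' ↦ hgder s ⟨ht₂.1.trans hs'.1.le, hs'.2.le.trans ht₁.2⟩)
        refine ⟨ζ, ⟨ht₂.1.trans hζ.1.le, hζ.2.le.trans ht₁.2⟩, ?_, ?_⟩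
        · rw [abs_of_neg (sub_neg.2 hζ.2), abs_of_neg (sub_neg.2 hgt)]; linarith [hζ.1]
        · have e1 : g t₁ - g t₂ = g' ζ * (t₁ - t₂) := by
            rw [hζ', div_mul_cancel₀ _ (sub_ne_zero.2 hgt.ne')]
          linarith
    obtain ⟨ζ, hζ, hζabs, hge⟩ := key
    rw [hg0, sub_zero] at hge
    have hgζ : |g' ζ| ≤ |ζ - t₁| * (devQ G (2 * q) : ℝ) := hslope ζ hζ
    have hdev0 : (0 : ℝ) ≤ (devQ G (2 * q) : ℝ) := by unfold devQ; push_cast; positivity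
    calc |g t₂| = |g' ζ| * |t₂ - t₁| := by rw [hge, abs_mul]
      _ ≤ (|ζ - t₁| * (devQ G (2 * q) : ℝ)) * |t₂ - t₁| := mul_le_mul_of_nonneg_right hgζ (abs_nonneg _)
      _ ≤ (|t₂ - t₁| * (devQ G (2 * q) : ℝ)) * |t₂ - t₁| :=
          mul_le_mul_of_nonneg_right (mul_le_mul_of_nonneg_right hζabs hdev0) (abs_nonneg _)
      _ = (t₂ - t₁) ^ 2 * (devQ G (2 * q) : ℝ) := by rw [← sq_abs (t₂ - t₁)]; ring
  have e3 : g t₂ = e.eval (Function.update z m t₂) - e.eval (Function.update z m t₁)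
      - (pderiv m e).eval (Function.update z m t₁) * (t₂ - t₁) - (q : ℝ) * (t₂ - t₁) ^ 2 := rfl
  rw [← e3]; exact main

/-! ### The box theorem: second-order centred form with certified remainder -/

/-- **THE SECOND-ORDER CENTRED FORM WITH A CERTIFIED REMAINDER.** If `e` is smooth with variables `< K`, the
kernel's extensions of `e`, of every `∂_m e` and of every `∂_l ∂_m e` succeed on the box `B` (centre `c`,
half-widths `w`) and point enclosures `Ic m ∋ ∂_m e(c)` are given, then for ANY rationals `a_m`,
`a2 m l` and `q_m` and every `x ∈ B` (`δ = x − c`):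
`|e(x) − e(c) − Σ_{m<K} (a_m δ_m + Σ_{l<m} a2 m l · δ_l δ_m + q_m δ_m²)|`
`  ≤ Σ_{m<K} (w_m · (dev(Ic m, a_m) + Σ_{l<K} w_l · dev([∂_l∂_m e](B), a2 m l)) + w_m² · dev([∂_m∂_m e](B), 2 q_m))`.
[cite: Moore1979, §4.4 eq. (4.19) (p. 43); Neumaier1991, Thm. 2.3.3; Neumaier1991, §2.4 remark (vii) (second-order
Taylor form, cubic approximation order)] -/
theorem abs_eval_sub_secondForm_le {prec iters K : ℕ} {B : Box} (e : RExpr) (hv : varsLT K e = true)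
    (hs : smooth e = true) (he : ∃ I, e.enclose prec iters B.toIvl = some I)
    (hD : ∀ m < K, ∃ I, (pderiv m e).enclose prec iters B.toIvl = some I)
    (G : ℕ → ℕ → NonemptyInterval ℚ)
    (hG : ∀ m < K, ∀ l < K, (pderiv l (pderiv m e)).enclose prec iters B.toIvl = some (G m l))
    (Ic : ℕ → NonemptyInterval ℚ)
    (hIc : ∀ m < K, (pderiv m e).enclose prec iters (fun i ↦ pure (B.cen i)) = some (Ic m))
    (a : ℕ → ℚ) (a2 : ℕ → ℕ → ℚ) (q : ℕ → ℚ) {x : ℕ → ℝ} (hx : B.mem x) :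
    |e.eval x - e.eval (fun i ↦ ((B.cen i : ℚ) : ℝ))
      - ∑ m ∈ range K, ((a m : ℝ) * (x m - ((B.cen m : ℚ) : ℝ))
          + (∑ l ∈ range m, (a2 m l : ℝ) * (x l - ((B.cen l : ℚ) : ℝ)) * (x m - ((B.cen m : ℚ) : ℝ)))
          + (q m : ℝ) * (x m - ((B.cen m : ℚ) : ℝ)) ^ 2)|
      ≤ ∑ m ∈ range K, (((B.hw m : ℚ) : ℝ) * ((devQ (Ic m) (a m) : ℝ)
            + ∑ l ∈ range K, ((B.hw l : ℚ) : ℝ) * (devQ (G m l) (a2 m l) : ℝ))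
          + ((B.hw m : ℚ) : ℝ) ^ 2 * (devQ (G m m) (2 * q m) : ℝ)) := by
  -- notation
  set c : ℕ → ℝ := fun i ↦ ((B.cen i : ℚ) : ℝ) with hc
  set w : ℕ → ℝ := fun i ↦ ((B.hw i : ℚ) : ℝ) with hwdef
  let δ : ℕ → ℝ := fun i ↦ x i - c i
  have hδ : ∀ i, |δ i| ≤ w i := fun i ↦ abs_sub_cen_le₂ hx i
  have hw0 : ∀ i, 0 ≤ w i := fun i ↦ hw_nonneg₂ hx i
  -- the staircase
  let y : ℕ → ℕ → ℝ := fun m i ↦ if i < m then x i else c i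
  have hy_mem : ∀ m, B.mem (y m) := fun m i ↦ by
    by_cases him : i < m
    · simp only [y, if_pos him]; exact hx i
    · simp only [y, if_neg him]; exact mem_cen₂ hx i
  have hy0 : y 0 = fun i ↦ c i := by funext i; simp [y]
  have hyK : e.eval (y K) = e.eval x := eval_congr₂ (fun i hi ↦ by simp only [y, if_pos hi]) e hv
  have hstep : ∀ m, y (m + 1) = Function.update (y m) m (x m) := by
    intro m; funext i
    by_cases him : i = m
    · subst him; simp [y]
    · rw [Function.update_of_ne him]
      by_cases hlt : i < m
      · simp [y, hlt, Nat.lt_succ_of_lt hlt]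
      · have : ¬ i < m + 1 := fun h ↦ him (by omega)
        simp [y, hlt, this]
  have hsame : ∀ m, y m = Function.update (y m) m (c m) := by
    intro m
    have : y m m = c m := by simp [y]
    rw [← this, Function.update_eq_self]
  have hysub : ∀ m l, y m l - c l = if l < m then δ l else 0 := by
    intro m l; by_cases h : l < m <;> simp [y, δ, h]
  -- per-step model and bound
  let M : ℕ → ℝ := fun m ↦ (a m : ℝ) * δ m + (∑ l ∈ range m, (a2 m l : ℝ) * δ l * δ m) + (q m : ℝ) * δ m ^ 2
  have hM : ∀ m, M m = (a m : ℝ) * δ m + (∑ l ∈ range m, (a2 m l : ℝ) * δ l) * δ m + (q m : ℝ) * δ m ^ 2 :=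
    fun m ↦ by simp only [M, Finset.sum_mul]
  let R : ℕ → ℝ := fun m ↦ w m * ((devQ (Ic m) (a m) : ℝ) + ∑ l ∈ range K, w l * (devQ (G m l) (a2 m l) : ℝ))
    + w m ^ 2 * (devQ (G m m) (2 * q m) : ℝ)
  -- the one-step estimate
  have one : ∀ m < K, |e.eval (y (m + 1)) - e.eval (y m) - M m| ≤ R m := by
    intro m hmK
    have hcm : ((B.ivl m).1 : ℝ) ≤ c m ∧ c m ≤ ((B.ivl m).2 : ℝ) := mem_cen₂ hx m
    -- (1) second-order step along coordinate m from c m to x m at the point y m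
    have h1 := abs_eval_update_sub_quad_le (hy_mem m) m e hs he (hD m hmK) (hG m hmK m hmK) (q m) hcm (hx m)
    rw [← hsame m, ← hstep m] at h1
    -- (2) first-order expansion of ∂_m e at the staircase point y m around the centre
    have h2 := abs_eval_sub_centredForm_le (pderiv m e) (varsLT_pderiv K m e hv) (smooth_pderiv m e hs)
      (hD m hmK) (G m) (fun l hl ↦ hG m hmK l hl) (a2 m) (hy_mem m)
    -- (3) the centre value of ∂_m e
    have h3 := abs_eval_cen_sub_le (pderiv m e) (hIc m hmK) (a m)
    -- rewrite the sum of (2): Σ_{l<K} a2 (y_l − c_l) = Σ_{l<m} a2 δ_l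
    have hsum : ∑ l ∈ range K, (a2 m l : ℝ) * (y m l - c l) = ∑ l ∈ range m, (a2 m l : ℝ) * δ l := by
      rw [← Finset.sum_range_add_sum_Ico _ hmK.le]
      have hz : ∑ l ∈ Ico m K, (a2 m l : ℝ) * (y m l - c l) = 0 :=
        Finset.sum_eq_zero fun l hl ↦ by
          rw [hysub m l, if_neg (not_lt.2 (Finset.mem_Ico.1 hl).1), mul_zero]
      rw [hz, add_zero]
      exact Finset.sum_congr rfl fun l hl ↦ by rw [hysub m l, if_pos (Finset.mem_range.1 hl)]
    rw [hsum] at h2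
    -- assemble: E(y(m+1)) − E(y m) − M m = r1 + δ_m · ((∂e(c) − a_m) + r2)
    set dme := (pderiv m e).eval (y m) with hdme
    set dmec := (pderiv m e).eval (fun i ↦ c i) with hdmec
    have eq : e.eval (y (m + 1)) - e.eval (y m) - M m
        = (e.eval (y (m + 1)) - e.eval (y m) - dme * (x m - c m) - (q m : ℝ) * (x m - c m) ^ 2)
          + δ m * ((dme - dmec - ∑ l ∈ range m, (a2 m l : ℝ) * δ l) + (dmec - (a m : ℝ))) := by
      rw [hM m]; simp only [δ]; ring
    rw [eq]
    have hbr : |(dme - dmec - ∑ l ∈ range m, (a2 m l : ℝ) * δ l) + (dmec - (a m : ℝ))|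
        ≤ (∑ l ∈ range K, w l * (devQ (G m l) (a2 m l) : ℝ)) + (devQ (Ic m) (a m) : ℝ) :=
      (abs_add_le _ _).trans (add_le_add h2 h3)
    have hδm : |δ m| ≤ w m := hδ m
    have hdev2 : (0 : ℝ) ≤ (devQ (G m m) (2 * q m) : ℝ) := by unfold devQ; push_cast; positivity
    have hsq : (x m - c m) ^ 2 ≤ w m ^ 2 := by
      have := hδ m; rw [abs_le] at this
      nlinarith [this.1, this.2, hw0 m]
    calc |(e.eval (y (m + 1)) - e.eval (y m) - dme * (x m - c m) - (q m : ℝ) * (x m - c m) ^ 2)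
            + δ m * ((dme - dmec - ∑ l ∈ range m, (a2 m l : ℝ) * δ l) + (dmec - (a m : ℝ)))|
        ≤ |e.eval (y (m + 1)) - e.eval (y m) - dme * (x m - c m) - (q m : ℝ) * (x m - c m) ^ 2|
            + |δ m| * |(dme - dmec - ∑ l ∈ range m, (a2 m l : ℝ) * δ l) + (dmec - (a m : ℝ))| := by
          refine (abs_add_le _ _).trans ?_; rw [abs_mul]
      _ ≤ (x m - c m) ^ 2 * (devQ (G m m) (2 * q m) : ℝ)
            + w m * ((∑ l ∈ range K, w l * (devQ (G m l) (a2 m l) : ℝ)) + (devQ (Ic m) (a m) : ℝ)) :=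
          add_le_add h1 (mul_le_mul hδm hbr (abs_nonneg _) (hw0 m))
      _ ≤ R m := by
          have := mul_le_mul_of_nonneg_right hsq hdev2
          simp only [R]; linarith
  -- induction along the staircase
  have main : ∀ m ≤ K, |e.eval (y m) - e.eval (y 0) - ∑ k ∈ range m, M k| ≤ ∑ k ∈ range m, R k := by
    intro m
    induction m with
    | zero => intro _; simp
    | succ m ih =>
      intro hm
      have hmK : m < K := Nat.lt_of_succ_le hm
      have h1 := ih hmK.le
      have h2 := one m hmK
      rw [sum_range_succ, sum_range_succ]
      calc |e.eval (y (m + 1)) - e.eval (y 0) - (∑ k ∈ range m, M k + M m)|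
          = |(e.eval (y (m + 1)) - e.eval (y m) - M m) + (e.eval (y m) - e.eval (y 0) - ∑ k ∈ range m, M k)| := by
            ring_nf
        _ ≤ |e.eval (y (m + 1)) - e.eval (y m) - M m| + |e.eval (y m) - e.eval (y 0) - ∑ k ∈ range m, M k| :=
            abs_add_le _ _
        _ ≤ R m + ∑ k ∈ range m, R k := add_le_add h2 h1
        _ = ∑ k ∈ range m, R k + R m := add_comm _ _
  have h := main K le_rfl
  rw [hyK, hy0] at h
  exact h

/-! ### The computable second-order entry check -/

/-- The certified second-order remainder: `dev(E(c), a₀) + Σ_m (w_m·(dev([∂_m e](c), a_m) + Σ_l w_l·dev([∂_l∂_m e](B), a2 m l)) + w_m²·dev([∂_m∂_m e](B), 2 q_m))`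
(failed enclosures contribute junk; `aff2EntryOK` requires them all to succeed).
[cite: Moore1979, §4.4 eq. (4.19) (p. 43)] -/
def rem2Q (K prec iters : ℕ) (e : RExpr) (B : Box) (a0 : ℚ) (a : ℕ → ℚ) (a2 : ℕ → ℕ → ℚ) (q : ℕ → ℚ) : ℚ :=
  devQ ((e.enclose prec iters fun i ↦ pure (B.cen i)).getD (pure 0)) a0
    + rsum K fun m ↦
        B.hw m * (devQ (((pderiv m e).enclose prec iters fun i ↦ pure (B.cen i)).getD (pure 0)) (a m)
            + rsum K fun l ↦ B.hw l * devQ (((pderiv l (pderiv m e)).enclose prec iters B.toIvl).getD (pure 0)) (a2 m l))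
        + B.hw m * B.hw m * devQ (((pderiv m (pderiv m e)).enclose prec iters B.toIvl).getD (pure 0)) (2 * q m)

/-- **Second-order entry check**: `e` smooth with variables `< K`; the extensions of `e`, of every `∂_m e`
(box and centre point) and of every `∂_l∂_m e` succeed; and the certified remainder is `≤ R`.
[cite: Moore1979, §4.4 eq. (4.19) (p. 43)] -/
def aff2EntryOK (K prec iters : ℕ) (e : RExpr) (B : Box) (a0 : ℚ) (a : ℕ → ℚ) (a2 : ℕ → ℕ → ℚ)
    (q : ℕ → ℚ) (R : ℚ) : Bool :=
  smooth e && varsLT K e && (e.enclose prec iters B.toIvl).isSome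
    && (e.enclose prec iters fun i ↦ pure (B.cen i)).isSome
    && (rall K fun m ↦ ((pderiv m e).enclose prec iters B.toIvl).isSome
        && ((pderiv m e).enclose prec iters fun i ↦ pure (B.cen i)).isSome
        && rall K fun l ↦ ((pderiv l (pderiv m e)).enclose prec iters B.toIvl).isSome)
    && decide (rem2Q K prec iters e B a0 a a2 q ≤ R)

/-- **Soundness of the second-order entry check**: the quadratic model
`a₀ + Σ_m (a_m δ_m + (Σ_{l<m} a2 m l · δ_l) δ_m + q_m δ_m²)` is within `R` of `e(x)` on the box.
[cite: Moore1979, §4.4 eq. (4.19) (p. 43); Neumaier1991, Thm. 2.3.3; Neumaier1991, §2.4 remark (vii) (second-order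
Taylor form, cubic approximation order)] -/
theorem aff2EntryOK_sound {K prec iters : ℕ} {e : RExpr} {B : Box} {a0 : ℚ} {a : ℕ → ℚ}
    {a2 : ℕ → ℕ → ℚ} {q : ℕ → ℚ} {R : ℚ} (h : aff2EntryOK K prec iters e B a0 a a2 q R = true)
    {x : ℕ → ℝ} (hx : B.mem x) :
    |e.eval x - ((a0 : ℝ) + ∑ m ∈ range K, ((a m : ℝ) * (x m - ((B.cen m : ℚ) : ℝ))
          + (∑ l ∈ range m, (a2 m l : ℝ) * (x l - ((B.cen l : ℚ) : ℝ)) * (x m - ((B.cen m : ℚ) : ℝ)))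
          + (q m : ℝ) * (x m - ((B.cen m : ℚ) : ℝ)) ^ 2))| ≤ (R : ℝ) := by
  unfold aff2EntryOK at h
  simp only [Bool.and_eq_true, decide_eq_true_eq, Option.isSome_iff_exists] at h
  obtain ⟨⟨⟨⟨⟨hs, hv⟩, ⟨I, hI⟩⟩, ⟨I0, hI0⟩⟩, hall⟩, hR⟩ := h
  have hD : ∀ m < K, ∃ J, (pderiv m e).enclose prec iters B.toIvl = some J := fun m hm ↦ by
    have := of_rall hall hm; simp only [Bool.and_eq_true, Option.isSome_iff_exists] at this; exact this.1.1
  have hIc' : ∀ m < K, ∃ J, (pderiv m e).enclose prec iters (fun i ↦ pure (B.cen i)) = some J := fun m hm ↦ by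
    have := of_rall hall hm; simp only [Bool.and_eq_true, Option.isSome_iff_exists] at this; exact this.1.2
  have hG' : ∀ m < K, ∀ l < K, ∃ J, (pderiv l (pderiv m e)).enclose prec iters B.toIvl = some J := fun m hm l hl ↦ by
    have := of_rall hall hm; simp only [Bool.and_eq_true, Option.isSome_iff_exists] at this
    have := of_rall this.2 hl; exact Option.isSome_iff_exists.1 this
  choose! Ic hIc using hIc'
  choose! G hG using hG'
  have h1 := abs_eval_sub_secondForm_le e hv hs ⟨I, hI⟩ hD G hG Ic hIc a a2 q hx
  have h2 := abs_eval_cen_sub_le e hI0 a0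
  have hrem : (devQ I0 a0 : ℝ) + ∑ m ∈ range K, (((B.hw m : ℚ) : ℝ) * ((devQ (Ic m) (a m) : ℝ)
        + ∑ l ∈ range K, ((B.hw l : ℚ) : ℝ) * (devQ (G m l) (a2 m l) : ℝ))
        + ((B.hw m : ℚ) : ℝ) ^ 2 * (devQ (G m m) (2 * q m) : ℝ)) ≤ (R : ℝ) := by
    have e1 : rem2Q K prec iters e B a0 a a2 q = devQ I0 a0 + ∑ m ∈ range K, (B.hw m * (devQ (Ic m) (a m)
        + ∑ l ∈ range K, B.hw l * devQ (G m l) (a2 m l)) + B.hw m * B.hw m * devQ (G m m) (2 * q m)) := by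
      unfold rem2Q
      rw [hI0, Option.getD_some, rsum_eq_sum]
      congr 1
      refine sum_congr rfl fun m hm ↦ ?_
      have hmK := mem_range.1 hm
      rw [hIc m hmK, Option.getD_some, hG m hmK m hmK, Option.getD_some, rsum_eq_sum]
      have hin : ∑ l ∈ range K, B.hw l * devQ (((pderiv l (pderiv m e)).enclose prec iters B.toIvl).getD (pure 0)) (a2 m l)
          = ∑ l ∈ range K, B.hw l * devQ (G m l) (a2 m l) :=
        sum_congr rfl fun l hl ↦ by rw [hG m hmK l (mem_range.1 hl), Option.getD_some]
      rw [hin]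
    have := hR; rw [e1] at this
    have := (Rat.cast_le (K := ℝ)).2 this
    push_cast at this
    have e2 : ∀ m, ((B.hw m : ℚ) : ℝ) * ((B.hw m : ℚ) : ℝ) = ((B.hw m : ℚ) : ℝ) ^ 2 := fun m ↦ by ring
    simp only [e2] at this
    exact this
  calc |e.eval x - ((a0 : ℝ) + ∑ m ∈ range K, ((a m : ℝ) * (x m - ((B.cen m : ℚ) : ℝ))
          + (∑ l ∈ range m, (a2 m l : ℝ) * (x l - ((B.cen l : ℚ) : ℝ)) * (x m - ((B.cen m : ℚ) : ℝ)))
          + (q m : ℝ) * (x m - ((B.cen m : ℚ) : ℝ)) ^ 2))|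
      = |(e.eval x - e.eval (fun i ↦ ((B.cen i : ℚ) : ℝ)) - ∑ m ∈ range K, ((a m : ℝ) * (x m - ((B.cen m : ℚ) : ℝ))
          + (∑ l ∈ range m, (a2 m l : ℝ) * (x l - ((B.cen l : ℚ) : ℝ)) * (x m - ((B.cen m : ℚ) : ℝ)))
          + (q m : ℝ) * (x m - ((B.cen m : ℚ) : ℝ)) ^ 2))
          + (e.eval (fun i ↦ ((B.cen i : ℚ) : ℝ)) - (a0 : ℝ))| := by ring_nf
    _ ≤ _ := abs_add_le _ _
    _ ≤ _ := add_le_add h1 h2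
    _ ≤ (R : ℝ) := by linarith

end RExpr

end Literature.Analysis.ValidatedNumerics
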